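import Literature.NumberTheory.LFunctions.Zhang2022.Section8Lemma84Core
import HarnessLib

/-!
# Zhang (2022), Lemma 8.4 — XI: bookkeeping of the four error pieces of the contour argument

Topic `Literature/NumberTheory/LFunctions/Zhang2022` (Landau–Siegel audit tree; verdict-neutral).
Y. Zhang, *Discrete mean estimates and the Landau–Siegel zero*, arXiv:2211.02515v1 (2022)
[Zhang2022LandauSiegel] — **an unrefereed manuscript under adjudication**; DAG node `Z22:Lem8.4.pf`
[Z22 p.47, tex L2399–2418]: the `O(ε₁)` / `O(𝓛⁻⁶)` absorptions of the contour argument ("moved in the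
same way as in the proof of Lemma 8.2": `x^{−1/𝓛} ≤ exp(−𝓛^{0.1}) = O(ε₁)`, `O(ε₁)𝓛^C = O(𝓛⁻⁶)`).

This file PROVES one real-variable inequality (`rhs_le`): with `𝓛 ≥ 3`, `α = π𝓛⁻⁹`, `η = c/(8𝓛)`,
height `T′ = D = e^{𝓛}`, `B_L = 2(4 + 3𝓛)`, `M_inv = 3C_inv𝓛`, `M_U ≤ A₁𝓛^m`, `𝓛^{1.1} ≤ log y ≤ 𝓛⁹`,
the four explicit error pieces of `Lemma84.lemma84_core` (file `Section8Lemma84Estimate`) add up to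
at most `C·𝓛⁻⁶·(∏_{q∣dr}(1−q⁻¹)⁻¹)²` with an explicit absolute `C`.

Nothing about the manuscript's Theorems 1–2 or about Landau–Siegel zeros is asserted.

## References

* Y. Zhang, arXiv:2211.02515v1 (2022), §8 Lemmas 8.2 and 8.4 (proofs, the `O(ε₁)` steps).
  [cite: Zhang2022LandauSiegel, §8 Lemma 8.4]
-/

noncomputable section

open Real

namespace Literature.NumberTheory.LFunctions.Zhang2022.Lemma84

/-! ### The bookkeeping of the four error pieces -/

set_option maxHeartbeats 800000 in
/-- **The four error pieces are `O(𝓛⁻⁶Π̂²)`.** With `𝓛 ≥ 3`, `α = π𝓛⁻⁹`, `η = c/(8𝓛)`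
(`0 < c ≤ 1/4`), `T′ = D = e^{𝓛}`, `B_L = 2(4 + 3𝓛)`, `M_inv = 3C_inv𝓛`, `M_U ≤ A₁𝓛^m`,
`𝓛^{1.1} ≤ L = log y ≤ 𝓛⁹` and `Π̂ ≥ 1`, the right-hand side of `Lemma84.lemma84_core` is at most
`C·𝓛⁻⁶·Π̂²` with the explicit `C` displayed in the statement (tails: `𝓛^{m+33}e^{−𝓛} ≤ (m+33)!`;
left side: `𝓛^{m+11}e^{−(c/8)𝓛^{1/10}} ≤ (10(m+11))!/(c/8)^{10(m+11)}`; horizontal sides: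
`𝓛^{m+9}e^{−2𝓛} ≤ (m+9)!/2^{m+9}`; small rectangle: `𝓛⁻¹⁵/α = 𝓛⁻⁶/π`).
[cite: Zhang2022LandauSiegel, §8 Lemma 8.4 (proof, the `O(ε₁)` and `O(𝓛⁻⁶)` steps)] -/
theorem rhs_le {𝓛 Ly c Cinv C K A₁ hatPi MU α η T BL Minv : ℝ} {m : ℕ}
    (h𝓛 : 3 ≤ 𝓛) (hc : 0 < c) (hc1 : c ≤ 1 / 4) (hCinv : 0 ≤ Cinv) (hC : 0 ≤ C) (hK : 1 ≤ K)
    (hA₁ : 0 ≤ A₁) (hMU0 : 0 ≤ MU) (hMU : MU ≤ A₁ * 𝓛 ^ m) (hPi : 1 ≤ hatPi)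
    (hLy1 : 𝓛 ^ (1.1 : ℝ) ≤ Ly) (hLy2 : Ly ≤ 𝓛 ^ 9)
    (hα : α = π / 𝓛 ^ 9) (hη : η = c / (8 * 𝓛)) (hT : T = Real.exp 𝓛) (hBL : BL = 2 * (4 + 3 * 𝓛))
    (hMinv : Minv = 3 * Cinv * 𝓛) :
    1 / (2 * π) * (2 * (Real.exp (α * Ly) * (MU * ((1 + α) / α) ^ 3) / T) +
        Real.exp (-η * Ly) * (MU * BL * BL * (Minv * (1 + 2 / η))) * (π / η) +
        2 * ((α + η) * (Real.exp (α * Ly) * (MU * BL * BL * (Minv * 3)) / T ^ 2)) +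
        56 * Real.exp (α * Ly / 2) *
          (hatPi ^ 2 * ((1 + 16 * Real.exp (9 / 2) * π ^ 2 * K ^ 2) / 𝓛 ^ 15) * (24 * K ^ 2 + 2 * K) +
            32 * K ^ 3 * (C * (𝓛 ^ 8)⁻¹ * hatPi) * (2 * Real.exp (9 / 2) * (1 + 𝓛) * 𝓛) * α) / α) ≤
      (1 / (2 * π) * (2 * Real.exp π * A₁ * (m + 33).factorial +
          40800 * π * A₁ * Cinv / c ^ 2 * ((10 * (m + 11)).factorial / (c / 8) ^ (10 * (m + 11))) +
          1800 * Real.exp π * A₁ * Cinv * ((m + 9).factorial / 2 ^ (m + 9)) +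
          56 * Real.exp π * ((1 + 16 * Real.exp (9 / 2) * π ^ 2 * K ^ 2) * (24 * K ^ 2 + 2 * K) / π +
            128 * K ^ 3 * C * Real.exp (9 / 2)))) *
        (𝓛 ^ 6)⁻¹ * hatPi ^ 2 := by
  subst hα hη hT hBL hMinv
  have h𝓛0 : 0 < 𝓛 := by linarith
  have h𝓛1 : 1 ≤ 𝓛 := by linarith
  have hπ0 := Real.pi_pos
  have hπ3 := Real.pi_gt_three
  have hπ4 := Real.pi_le_four
  have hL9 : 0 < 𝓛 ^ 9 := by positivity
  have hL93 : (3 : ℝ) ^ 9 ≤ 𝓛 ^ 9 := pow_le_pow_left₀ (by norm_num) h𝓛 9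
  have hα0 : 0 < π / 𝓛 ^ 9 := by positivity
  have hη0 : 0 < c / (8 * 𝓛) := by positivity
  have hLy0 : 0 ≤ Ly := le_trans (Real.rpow_nonneg h𝓛0.le _) hLy1
  set W : ℝ := (𝓛 ^ 6)⁻¹ * hatPi ^ 2 with hW
  have hW6 : (𝓛 ^ 6)⁻¹ ≤ W := by
    rw [hW]; exact le_mul_of_one_le_right (by positivity) (one_le_pow₀ hPi)
  have hW0 : 0 ≤ W := le_trans (by positivity) hW6
  -- `e^{αL} ≤ e^π`, `(1+α)/α ≤ 𝓛⁹`, `α + η ≤ 1`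
  have hαLy : π / 𝓛 ^ 9 * Ly ≤ π := by
    calc π / 𝓛 ^ 9 * Ly ≤ π / 𝓛 ^ 9 * 𝓛 ^ 9 := by gcongr
      _ = π := by field_simp
  have hexp1 : Real.exp (π / 𝓛 ^ 9 * Ly) ≤ Real.exp π := Real.exp_le_exp.2 hαLy
  have hαLy0 : 0 ≤ π / 𝓛 ^ 9 * Ly := by positivity
  have hexp2 : Real.exp (π / 𝓛 ^ 9 * Ly / 2) ≤ Real.exp π := Real.exp_le_exp.2 (by linarith)
  have hinvα : (1 + π / 𝓛 ^ 9) / (π / 𝓛 ^ 9) ≤ 𝓛 ^ 9 := by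
    rw [div_le_iff₀ hα0, show 𝓛 ^ 9 * (π / 𝓛 ^ 9) = π by field_simp]
    have : π / 𝓛 ^ 9 ≤ π / 3 ^ 9 := by gcongr
    nlinarith
  have hinvα0 : 0 ≤ (1 + π / 𝓛 ^ 9) / (π / 𝓛 ^ 9) := by positivity
  have hαη1 : π / 𝓛 ^ 9 + c / (8 * 𝓛) ≤ 1 := by
    have h1 : π / 𝓛 ^ 9 ≤ π / 3 ^ 9 := by gcongr
    have h2 : c / (8 * 𝓛) ≤ (1 / 4) / (8 * 3) := by gcongr
    nlinarith
  -- the polynomial factors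
  have hBL : 2 * (4 + 3 * 𝓛) ≤ 10 * 𝓛 := by linarith
  have hBL0 : 0 ≤ 2 * (4 + 3 * 𝓛) := by positivity
  have hMUm : MU ≤ A₁ * 𝓛 ^ m := hMU
  have h2η : 1 + 2 / (c / (8 * 𝓛)) ≤ 17 * 𝓛 / c := by
    rw [div_div_eq_mul_div, show 1 + 2 * (8 * 𝓛) / c = (c + 16 * 𝓛) / c by field_simp; ring]
    gcongr
    linarith
  have hπη : π / (c / (8 * 𝓛)) = 8 * π * 𝓛 / c := by rw [div_div_eq_mul_div]; ring
  -- piece 1: the tails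
  have t1 : 2 * (Real.exp (π / 𝓛 ^ 9 * Ly) * (MU * ((1 + π / 𝓛 ^ 9) / (π / 𝓛 ^ 9)) ^ 3) /
      Real.exp 𝓛) ≤ 2 * Real.exp π * A₁ * (m + 33).factorial * W := by
    have h1 : Real.exp (π / 𝓛 ^ 9 * Ly) * (MU * ((1 + π / 𝓛 ^ 9) / (π / 𝓛 ^ 9)) ^ 3) ≤
        Real.exp π * (A₁ * 𝓛 ^ m * (𝓛 ^ 9) ^ 3) := by gcongr
    have h2 : 𝓛 ^ m * (𝓛 ^ 9) ^ 3 / Real.exp 𝓛 ≤ (m + 33).factorial * (𝓛 ^ 6)⁻¹ := by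
      have h := pow_mul_exp_neg_le (a := 1) one_pos h𝓛0.le (m + 33)
      rw [one_pow, div_one, one_mul] at h
      have e : 𝓛 ^ m * (𝓛 ^ 9) ^ 3 / Real.exp 𝓛 = 𝓛 ^ (m + 33) * Real.exp (-𝓛) * (𝓛 ^ 6)⁻¹ := by
        rw [Real.exp_neg]; field_simp; ring
      rw [e]
      exact mul_le_mul_of_nonneg_right h (by positivity)
    calc 2 * (Real.exp (π / 𝓛 ^ 9 * Ly) * (MU * ((1 + π / 𝓛 ^ 9) / (π / 𝓛 ^ 9)) ^ 3) / Real.exp 𝓛)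
        ≤ 2 * (Real.exp π * (A₁ * 𝓛 ^ m * (𝓛 ^ 9) ^ 3) / Real.exp 𝓛) := by gcongr
      _ = 2 * Real.exp π * A₁ * (𝓛 ^ m * (𝓛 ^ 9) ^ 3 / Real.exp 𝓛) := by ring
      _ ≤ 2 * Real.exp π * A₁ * ((m + 33).factorial * (𝓛 ^ 6)⁻¹) := by gcongr
      _ ≤ 2 * Real.exp π * A₁ * ((m + 33).factorial * W) := by gcongr
      _ = _ := by ring
  -- piece 2: the left side
  have t2 : Real.exp (-(c / (8 * 𝓛)) * Ly) *
      (MU * (2 * (4 + 3 * 𝓛)) * (2 * (4 + 3 * 𝓛)) * (3 * Cinv * 𝓛 * (1 + 2 / (c / (8 * 𝓛))))) *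
        (π / (c / (8 * 𝓛))) ≤
      40800 * π * A₁ * Cinv / c ^ 2 * ((10 * (m + 11)).factorial / (c / 8) ^ (10 * (m + 11))) * W := by
    -- `e^{−ηL} ≤ e^{−(c/8)𝓛^{1/10}}`
    have hpow : 𝓛 ^ (1.1 : ℝ) = 𝓛 ^ (1 / 10 : ℝ) * 𝓛 := by
      rw [← Real.rpow_add_one h𝓛0.ne']; norm_num
    have hexpη : Real.exp (-(c / (8 * 𝓛)) * Ly) ≤ Real.exp (-(c / 8 * 𝓛 ^ (1 / 10 : ℝ))) := by
      rw [Real.exp_le_exp]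
      have e : c / (8 * 𝓛) * 𝓛 ^ (1.1 : ℝ) = c / 8 * 𝓛 ^ (1 / 10 : ℝ) := by
        rw [hpow]; field_simp
      have h1 : c / (8 * 𝓛) * 𝓛 ^ (1.1 : ℝ) ≤ c / (8 * 𝓛) * Ly := by gcongr
      linarith
    have hprod : MU * (2 * (4 + 3 * 𝓛)) * (2 * (4 + 3 * 𝓛)) * (3 * Cinv * 𝓛 * (1 + 2 / (c / (8 * 𝓛)))) *
        (π / (c / (8 * 𝓛))) ≤
        (A₁ * 𝓛 ^ m) * (10 * 𝓛) * (10 * 𝓛) * (3 * Cinv * 𝓛 * (17 * 𝓛 / c)) * (8 * π * 𝓛 / c) := by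
      rw [hπη]
      gcongr
    have hdec : 𝓛 ^ (m + 11) * Real.exp (-(c / 8 * 𝓛 ^ (1 / 10 : ℝ))) ≤
        ((10 * (m + 11)).factorial : ℝ) / (c / 8) ^ (10 * (m + 11)) :=
      pow_mul_exp_neg_tenth_le (a := c / 8) (by positivity) h𝓛0.le (m + 11)
    have hA𝓛 : 0 ≤ A₁ * 𝓛 ^ m := mul_nonneg hA₁ (pow_nonneg h𝓛0.le m)
    have h10 : (0 : ℝ) ≤ 10 * 𝓛 := by linarith
    have h17 : 0 ≤ 3 * Cinv * 𝓛 * (17 * 𝓛 / c) :=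
      mul_nonneg (mul_nonneg (mul_nonneg (by norm_num) hCinv) h𝓛0.le)
        (div_nonneg (by linarith) hc.le)
    have h8 : 0 ≤ 8 * π * 𝓛 / c := div_nonneg (by positivity) hc.le
    have hP0 : 0 ≤ (A₁ * 𝓛 ^ m) * (10 * 𝓛) * (10 * 𝓛) * (3 * Cinv * 𝓛 * (17 * 𝓛 / c)) *
        (8 * π * 𝓛 / c) := mul_nonneg (mul_nonneg (mul_nonneg (mul_nonneg hA𝓛 h10) h10) h17) h8
    calc Real.exp (-(c / (8 * 𝓛)) * Ly) *
          (MU * (2 * (4 + 3 * 𝓛)) * (2 * (4 + 3 * 𝓛)) * (3 * Cinv * 𝓛 * (1 + 2 / (c / (8 * 𝓛))))) *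
          (π / (c / (8 * 𝓛)))
        = Real.exp (-(c / (8 * 𝓛)) * Ly) *
          ((MU * (2 * (4 + 3 * 𝓛)) * (2 * (4 + 3 * 𝓛)) * (3 * Cinv * 𝓛 * (1 + 2 / (c / (8 * 𝓛))))) *
          (π / (c / (8 * 𝓛)))) := by ring
      _ ≤ Real.exp (-(c / (8 * 𝓛)) * Ly) *
          ((A₁ * 𝓛 ^ m) * (10 * 𝓛) * (10 * 𝓛) * (3 * Cinv * 𝓛 * (17 * 𝓛 / c)) * (8 * π * 𝓛 / c)) :=
          mul_le_mul_of_nonneg_left hprod (Real.exp_pos _).le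
      _ ≤ Real.exp (-(c / 8 * 𝓛 ^ (1 / 10 : ℝ))) *
          ((A₁ * 𝓛 ^ m) * (10 * 𝓛) * (10 * 𝓛) * (3 * Cinv * 𝓛 * (17 * 𝓛 / c)) * (8 * π * 𝓛 / c)) :=
          mul_le_mul_of_nonneg_right hexpη hP0
      _ = 40800 * π * A₁ * Cinv / c ^ 2 * (𝓛 ^ (m + 11) * Real.exp (-(c / 8 * 𝓛 ^ (1 / 10 : ℝ)))) *
          (𝓛 ^ 6)⁻¹ := by
          field_simp; ring
      _ ≤ 40800 * π * A₁ * Cinv / c ^ 2 * (((10 * (m + 11)).factorial : ℝ) / (c / 8) ^ (10 * (m + 11))) *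
          (𝓛 ^ 6)⁻¹ := by gcongr
      _ ≤ _ := by gcongr
  -- piece 3: the horizontal sides
  have t3 : 2 * ((π / 𝓛 ^ 9 + c / (8 * 𝓛)) * (Real.exp (π / 𝓛 ^ 9 * Ly) *
      (MU * (2 * (4 + 3 * 𝓛)) * (2 * (4 + 3 * 𝓛)) * (3 * Cinv * 𝓛 * 3)) / Real.exp 𝓛 ^ 2)) ≤
      1800 * Real.exp π * A₁ * Cinv * ((m + 9).factorial / 2 ^ (m + 9)) * W := by
    have h1 : Real.exp (π / 𝓛 ^ 9 * Ly) * (MU * (2 * (4 + 3 * 𝓛)) * (2 * (4 + 3 * 𝓛)) *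
        (3 * Cinv * 𝓛 * 3)) ≤ Real.exp π * ((A₁ * 𝓛 ^ m) * (10 * 𝓛) * (10 * 𝓛) * (3 * Cinv * 𝓛 * 3)) := by
      gcongr
    have hdec : 𝓛 ^ (m + 9) * Real.exp (-(2 * 𝓛)) ≤ ((m + 9).factorial : ℝ) / 2 ^ (m + 9) :=
      pow_mul_exp_neg_le (a := 2) (by norm_num) h𝓛0.le (m + 9)
    have hexp2𝓛 : Real.exp 𝓛 ^ 2 = Real.exp (2 * 𝓛) := by rw [← Real.exp_nat_mul]; norm_num
    have hnum0 : 0 ≤ Real.exp (π / 𝓛 ^ 9 * Ly) * (MU * (2 * (4 + 3 * 𝓛)) * (2 * (4 + 3 * 𝓛)) *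
        (3 * Cinv * 𝓛 * 3)) / Real.exp 𝓛 ^ 2 := by positivity
    calc 2 * ((π / 𝓛 ^ 9 + c / (8 * 𝓛)) * (Real.exp (π / 𝓛 ^ 9 * Ly) *
          (MU * (2 * (4 + 3 * 𝓛)) * (2 * (4 + 3 * 𝓛)) * (3 * Cinv * 𝓛 * 3)) / Real.exp 𝓛 ^ 2))
        ≤ 2 * (1 * (Real.exp π * ((A₁ * 𝓛 ^ m) * (10 * 𝓛) * (10 * 𝓛) * (3 * Cinv * 𝓛 * 3)) /
            Real.exp 𝓛 ^ 2)) := by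
          gcongr 2 * ?_
          exact mul_le_mul hαη1 (by gcongr) hnum0 zero_le_one
      _ = 1800 * Real.exp π * A₁ * Cinv * (𝓛 ^ (m + 9) * Real.exp (-(2 * 𝓛))) * (𝓛 ^ 6)⁻¹ := by
          rw [hexp2𝓛, Real.exp_neg]; field_simp; ring
      _ ≤ 1800 * Real.exp π * A₁ * Cinv * (((m + 9).factorial : ℝ) / 2 ^ (m + 9)) * (𝓛 ^ 6)⁻¹ := by
          gcongr
      _ ≤ _ := by gcongr
  -- piece 4: the small rectangle
  have t4 : 56 * Real.exp (π / 𝓛 ^ 9 * Ly / 2) *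
      (hatPi ^ 2 * ((1 + 16 * Real.exp (9 / 2) * π ^ 2 * K ^ 2) / 𝓛 ^ 15) * (24 * K ^ 2 + 2 * K) +
        32 * K ^ 3 * (C * (𝓛 ^ 8)⁻¹ * hatPi) * (2 * Real.exp (9 / 2) * (1 + 𝓛) * 𝓛) * (π / 𝓛 ^ 9)) /
        (π / 𝓛 ^ 9) ≤
      56 * Real.exp π * ((1 + 16 * Real.exp (9 / 2) * π ^ 2 * K ^ 2) * (24 * K ^ 2 + 2 * K) / π +
        128 * K ^ 3 * C * Real.exp (9 / 2)) * W := by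
    set C₅ : ℝ := 1 + 16 * Real.exp (9 / 2) * π ^ 2 * K ^ 2 with hC₅
    have hC₅0 : 0 ≤ C₅ := by positivity
    have e : 56 * Real.exp (π / 𝓛 ^ 9 * Ly / 2) * (hatPi ^ 2 * (C₅ / 𝓛 ^ 15) * (24 * K ^ 2 + 2 * K) +
        32 * K ^ 3 * (C * (𝓛 ^ 8)⁻¹ * hatPi) * (2 * Real.exp (9 / 2) * (1 + 𝓛) * 𝓛) * (π / 𝓛 ^ 9)) /
        (π / 𝓛 ^ 9) =
        56 * Real.exp (π / 𝓛 ^ 9 * Ly / 2) * ((C₅ * (24 * K ^ 2 + 2 * K) / π) * (𝓛 ^ 6)⁻¹ * hatPi ^ 2 +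
          64 * K ^ 3 * C * Real.exp (9 / 2) * ((1 + 𝓛) * 𝓛 / 𝓛 ^ 2) * ((𝓛 ^ 6)⁻¹ * hatPi)) := by
      field_simp; ring
    have h1 : (1 + 𝓛) * 𝓛 / 𝓛 ^ 2 ≤ 2 := by
      rw [div_le_iff₀ (by positivity)]
      have h11 : 𝓛 ≤ 𝓛 * 𝓛 := le_mul_of_one_le_left h𝓛0.le h𝓛1
      have e1 : (1 + 𝓛) * 𝓛 = 𝓛 + 𝓛 * 𝓛 := by ring
      have e2 : (2 : ℝ) * 𝓛 ^ 2 = 𝓛 * 𝓛 + 𝓛 * 𝓛 := by ring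
      rw [e1, e2]; linarith
    have h2 : (𝓛 ^ 6)⁻¹ * hatPi ≤ W := by
      rw [hW]
      exact mul_le_mul_of_nonneg_left (le_self_pow₀ hPi (by norm_num)) (by positivity)
    rw [e]
    have hin : (C₅ * (24 * K ^ 2 + 2 * K) / π) * (𝓛 ^ 6)⁻¹ * hatPi ^ 2 +
        64 * K ^ 3 * C * Real.exp (9 / 2) * ((1 + 𝓛) * 𝓛 / 𝓛 ^ 2) * ((𝓛 ^ 6)⁻¹ * hatPi) ≤
        (C₅ * (24 * K ^ 2 + 2 * K) / π) * W + 64 * K ^ 3 * C * Real.exp (9 / 2) * 2 * W := by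
      apply add_le_add
      · rw [hW]; exact le_of_eq (by ring)
      · have h64 : 0 ≤ 64 * K ^ 3 * C * Real.exp (9 / 2) := by positivity
        calc 64 * K ^ 3 * C * Real.exp (9 / 2) * ((1 + 𝓛) * 𝓛 / 𝓛 ^ 2) * ((𝓛 ^ 6)⁻¹ * hatPi)
            ≤ 64 * K ^ 3 * C * Real.exp (9 / 2) * 2 * ((𝓛 ^ 6)⁻¹ * hatPi) := by
              apply mul_le_mul_of_nonneg_right _ (by positivity)
              exact mul_le_mul_of_nonneg_left h1 h64
          _ ≤ 64 * K ^ 3 * C * Real.exp (9 / 2) * 2 * W :=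
              mul_le_mul_of_nonneg_left h2 (by positivity)
    have hsum0 : 0 ≤ (C₅ * (24 * K ^ 2 + 2 * K) / π) * (𝓛 ^ 6)⁻¹ * hatPi ^ 2 +
        64 * K ^ 3 * C * Real.exp (9 / 2) * ((1 + 𝓛) * 𝓛 / 𝓛 ^ 2) * ((𝓛 ^ 6)⁻¹ * hatPi) := by
      positivity
    calc 56 * Real.exp (π / 𝓛 ^ 9 * Ly / 2) * ((C₅ * (24 * K ^ 2 + 2 * K) / π) * (𝓛 ^ 6)⁻¹ * hatPi ^ 2 +
          64 * K ^ 3 * C * Real.exp (9 / 2) * ((1 + 𝓛) * 𝓛 / 𝓛 ^ 2) * ((𝓛 ^ 6)⁻¹ * hatPi))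
        ≤ 56 * Real.exp π * ((C₅ * (24 * K ^ 2 + 2 * K) / π) * W +
          64 * K ^ 3 * C * Real.exp (9 / 2) * 2 * W) :=
          mul_le_mul (mul_le_mul_of_nonneg_left hexp2 (by norm_num)) hin hsum0 (by positivity)
      _ = _ := by ring
  -- sum
  have hsum := add_le_add (add_le_add (add_le_add t1 t2) t3) t4
  calc _ ≤ 1 / (2 * π) * ((2 * Real.exp π * A₁ * (m + 33).factorial +
          40800 * π * A₁ * Cinv / c ^ 2 * ((10 * (m + 11)).factorial / (c / 8) ^ (10 * (m + 11))) +
          1800 * Real.exp π * A₁ * Cinv * ((m + 9).factorial / 2 ^ (m + 9)) +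
          56 * Real.exp π * ((1 + 16 * Real.exp (9 / 2) * π ^ 2 * K ^ 2) * (24 * K ^ 2 + 2 * K) / π +
            128 * K ^ 3 * C * Real.exp (9 / 2))) * W) := by
        refine mul_le_mul_of_nonneg_left ?_ (by positivity)
        refine hsum.trans (le_of_eq ?_)
        ring
    _ = _ := by rw [hW]; ring

end Literature.NumberTheory.LFunctions.Zhang2022.Lemma84
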